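import Summits.AtomisticToContinuum.Crystallization.Theorems.ChartedZeroExcessLayeredLatticeLiouvilleZZZYRA

/-!
# Charted zero-excess layered-lattice Liouville — ZZZYRB: «ClusterCertificate», the glued split of the signed shell budget (SP♯)

Cell `decomp-a2c`, lens 2 «structural dichotomy (special | generic)», generation 97, second node (D′).  NODE D «RigiditySplit» (tree ZZZYRA,
(191) p858360) proved `(RI♯) ∧ (K♯) ∧ (SD♯) ∧ (SP♯) ∧ (CZ♯) ⇒ (U♯) UniformEquilStabilityAt`.  Its special-side crux (SP♯) `SignedShellBudgetP`
quantifies `∀ a, ∃ (scalar multipliers), ∀ words`: as typed it (i) lets the budget degenerate (`γS = γ = 0`, `γN = κ₁`) into «`κ₁·N₁ − γT·Z ≤ E/2`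
on every admissible word», i.e. uniform stability in contact-displacement currency — the whole difficulty — and (ii) prices mixed in-plane /
interlayer geometries (the clean proxy admits an interlayer/in-plane ratio `ρ ∈ [0.96, 1.04]`) by SCALAR contact coefficients, which is razor-thin
(desk: `κ₁ ≈ 0.005–0.05` at `(P, ρ) = (1.0, 1.04)`), although the true Bloch constant there is `0.33` (desk CASTRAIN-97: `κ_full ≥ 0.28` on the
whole clean `(P, ρ)` box).  This file CLOSES BOTH GAPS by splitting (SP♯) along the lens once more, now over finite CLUSTERS:

* **(HS♯) `HessianSignSplitP`** [support · ATTACKABLE-S · per-pair algebra]: the harmonic form dominates, pair by pair, the SIGNED RADIAL TABLE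
  `radCoef` (contact `V'' − V'/r` on the stretch, far `min(V'', 0)` on the stretch, window `(r₁, ϱ]`) plus the contact TRANSVERSE table `V'/r` on the
  full difference, minus a displacement-currency middle tail `τ·N₁` and the (T) extreme tail `γT·nnFormZ` — the exact identity
  `bondHess e v = (V''(ℓ) − V'(ℓ)/ℓ)·s² + (V'(ℓ)/ℓ)·‖v‖²` on contact bonds (ZZZYJ `bondHess`, B `forceConst_apply`), `V'(d)/d > 0` dropped on far
  bonds (`d ≥ 6/5 > 1`, NashForceBalance `ljDeriv_pos_of_one_lt`), UY `norm_layeredKernel_le` + a contact-path count for `(ϱ, ϱ₀]`, UW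
  `tailDominationCert_holds` beyond.
* **(PU♯) `PartitionIdentityP`** [support · ATTACKABLE-S · finsum algebra]: the smooth CLUSTER PARTITION OF UNITY on pairs — centre weights
  `siteWeight R` (padded quartic bump `clusterBump` of the distance to the centre, cut at radius `R`), pair weight = product, normalised by the pair's
  own mass `pairMass` — resums the signed radial table minus `μ·S₁` into the cluster forms: `Σ_c clusterForm μ c φ = radialSum φ − μ·S₁(φ)`
  (Fubini for finitely supported finsums; every pair of length `≤ ϱ` has positive mass once `R ≥ ϱ/2 + 1`).
* **(TB♯) `TransverseBoundP`** [support · ATTACKABLE-S · termwise]: a lower bound `β ≤ V'(ℓ)/ℓ` on the contact bonds of the word gives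
  `β·N₁ ≤ transSum`.
* ★ **(JC♯) `ClusterCertificateP`** [crux (rank 3) · SPECIAL · INSTRUMENTED · the ONLY piece with Lennard-Jones numbers in it]: for every admissible
  word there are TWO NUMBERS `μ, β` with the closure `2(κ₁ + τ) ≤ μ·cK + β`, `2(κ₁ + τ) ≤ μ + β`, the tension floor `β ≤ V'(ℓ)/ℓ` on its contact
  bonds, and, CENTRE BY CENTRE, the finite-dimensional inequality `0 ≤ clusterForm μ c φ` — a statement about the `≤ 79` (`R = √5`) resp. `≤ 141`
  (`R = 2√2`) atoms around one site, i.e. one symmetric matrix per (cluster TYPE, geometry box) being positive semidefinite on its stretch space.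
  LOCAL, hence it cannot swallow (U♯); word-uniformity is automatic because the matrices depend only on the cluster's Hägg type (`≤ 9` letters) and
  its geometry box.  Desk JOINT-97 (pure python, smooth profile `b0.15`, `R = √5`, `ϱ = 49/20`): over ALL 72 nine-layer stacking environments at
  `P = Q` the certified `κ_w = μ·cK + β` is `≥ [4.93, 1.33, 0.466, 0.198]` at `r₁ = [0.8602, 0.9375, 1, 1.0442]` (cluster / exact-Bloch loss
  `1.05–1.07`); over the clean `(P, ρ)` box (23 geometries × {fcc, hcp}) `min κ_w = 0.092` at the mixed tensile corner `(1.0442, 0.96)` (fcc type;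
  hcp `0.101`), the six smallest values `0.092–0.128` all on the mixed tensile edges `(1.0442, 0.96)`, `(1, 1.04)`, `(1.02, 0.96)`, `≥ 0.145`
  everywhere else; extending the stretch window to `ϱ = 3.47` (`R = 2√2`, 141 atoms) costs `≤ 0.135` in `μ` (`≈ 0.017` in `κ_w`).
  UNDECIDED(test): the `s = 1/50` in-plane-anisotropy boxes and the interval version of the 72 × (geometry-box) matrix family — the census
  K-file object.
* GLUE (PROVED here): `(K♯) ∧ (HS♯) ∧ (PU♯) ∧ (TB♯) ∧ (JC♯) ⇒ (SP♯)` for EVERY window list `(n, ρ, C)` (the far windows are no longer needed: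
  `γ = 0`, `γS = 0`, `γN = κ₁` — the per-word pair `(μ, β)` is uniformised through the two-sided Korn inequality), `(SD♯)` at `n = 0` is vacuous,
  and hence `(RI♯) ∧ (K♯) ∧ (HS♯) ∧ (PU♯) ∧ (TB♯) ∧ (JC♯) ∧ (CZ♯) ⇒ (U♯)` through the tree door `uniformEquilStabilityAt_of_rigiditySplit`.

Lens statement.  Objects = interacting pairs, as in NODE D; the special side is now resolved one level further: GENERIC = everything that is
potential-free or per-pair algebra ((K♯) Korn of the contact truss, (PU♯) partition algebra, (TB♯), (HS♯) sign bookkeeping); SPECIAL = (JC♯), a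
finite family of explicit matrices indexed by the finitely many cluster types of Barlow words (exhaustion: clean ⇒ two-shell pattern ⇒ every
`R`-cluster of an admissible word is a strained copy of one of the 72 nine-letter Hägg environments' clusters; the strain box is the clean window).
Conventions: all pair sums are over ORDERED index pairs (each bond twice), `E` is the ordered-pair `HasSum` value of B `CoerciveZ`, so the true second
variation is `E/2` and (HS♯) carries the honest factor `1/2`; desk constants `μ, β, κ_w` are in true-Hessian units per bond (`V''(1) = 6`), the door's
`κ₁` is `κ_w/2 − τ`.

POST-MORTEM HOOKS.  (JC♯) false for every `(R, ϱ, μ)` with `μ·cK + β > 0` at some admissible geometry ⇒ the cluster route cannot certify (U♯) there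
and the residual is a genuinely global (Bloch-type) certificate on that geometry box — census CASTRAIN-type instrument decides (U♯) itself there
(`κ_full ≥ 0.28` says (U♯) is not in danger; only the certificate would be).  (HS♯)/(PU♯)/(TB♯) fail only by mis-set tables (they are identities and
termwise bounds).
-/

open scoped BigOperators InnerProductSpace RealInnerProductSpace
open MeasureTheory Set Metric Filter Topology

namespace Summit.AtomisticToContinuum.Crystallization.Theorems.ChartedZeroExcessLayeredLatticeLiouville

open Summit.AtomisticToContinuum.Crystallization.Theorems.ChartedPlanarOrderRigidityDoor (E3 IsClean IsNash)
open Summit.AtomisticToContinuum.Crystallization.Theorems.ChartedPlanarOrderDensityDichotomy (μS)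
open Summit.AtomisticToContinuum.Crystallization.Theorems.ChartedPlanarOrderMesoCut (LayeredHom)
open Summit.AtomisticToContinuum.Crystallization.Theorems.ChartedPlanarOrderDoorLayered (Layered)
open Summit.AtomisticToContinuum.Crystallization.Theorems.ChartedPlanarOrderNashForceBalance (ljDeriv)
open Literature.MathematicalPhysics.StatisticalMechanics (triangularVec₁ triangularVec₂)

noncomputable section

/-! ### The cluster partition of unity and the signed tables -/

/-- PADDED QUARTIC BUMP `(1 − (20t/23)²)²`: the radial profile of a cluster weight (`t` = distance to the centre / `R`; positive up to the cut `t = 1`,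
padding `3/20` — desk JOINT-97 profile `b0.15`: indicator weights make the cluster constants DIVERGE with `R` by boundary rattling, profiles vanishing AT
the cut make the outer shell's pairs massless). [g97] -/
def clusterBump (t : ℝ) : ℝ := (1 - (20 * t / 23) ^ 2) ^ 2

/-- WEIGHT OF THE SITE `p` IN THE CLUSTER CENTRED AT THE SITE `c` (radius `R`, Euclidean distance of the sites). [g97] -/
def siteWeight (R : ℝ) (a b : E3) (w : ℤ → E3) (c p : Cell 2 × ℤ) : ℝ :=
  if ‖lsite a b w p.1 p.2 - lsite a b w c.1 c.2‖ ≤ R then clusterBump (‖lsite a b w p.1 p.2 - lsite a b w c.1 c.2‖ / R) else 0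

/-- WEIGHT OF THE (ordered) PAIR `x` IN THE CLUSTER CENTRED AT `c`: the product of its endpoints' weights. [g97] -/
def pairWeight (R : ℝ) (a b : E3) (w : ℤ → E3) (c : Cell 2 × ℤ) (x : (Cell 2 × ℤ) × (Cell 2 × ℤ)) : ℝ :=
  siteWeight R a b w c x.1 * siteWeight R a b w c x.2

/-- MASS OF THE PAIR `x`: its total weight over all centres (a finite sum on a co-Lipschitz word; positive for every pair of length `≤ 2(R − 1)`). [g97] -/
def pairMass (R : ℝ) (a b : E3) (w : ℤ → E3) (x : (Cell 2 × ℤ) × (Cell 2 × ℤ)) : ℝ :=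
  ∑ᶠ c : Cell 2 × ℤ, pairWeight R a b w c x

/-- THE SIGNED RADIAL TABLE of the budget at bond length `r`: on contact bonds (`0 < r ≤ r₁`) the full radial-minus-transverse coefficient
`V''(r) − V'(r)/r` (ZZZYJ `ljSecondDeriv`, NashForceBalance `ljDeriv`); on far bonds of the stretch window (`r₁ < r ≤ ϱ`) the radial DEFICIT
`min(V''(r), 0)`; zero beyond `ϱ`. [g97] -/
def radCoef (r₁ ϱ r : ℝ) : ℝ :=
  if 0 < r ∧ r ≤ r₁ then ljSecondDeriv r - ljDeriv r / r else if r₁ < r ∧ r ≤ ϱ then min (ljSecondDeriv r) 0 else 0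

/-- SQUARED STRETCH of the pair `x` under `φ`: `⟨e, Δφ⟩² / ‖e‖²`. [g97] -/
def sqStretch (a b : E3) (w : ℤ → E3) (φ : Cell 2 → ℤ → E3) (x : (Cell 2 × ℤ) × (Cell 2 × ℤ)) : ℝ :=
  ⟪bondVec a b w x, φ x.2.1 x.2.2 - φ x.1.1 x.1.2⟫ ^ 2 / ‖bondVec a b w x‖ ^ 2

/-- SIGNED RADIAL SUM `Σ_x radCoef(‖e_x‖)·s_x²` (ordered pairs). [g97] -/
def radialSum (r₁ ϱ : ℝ) (a b : E3) (w : ℤ → E3) (φ : Cell 2 → ℤ → E3) : ℝ :=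
  ∑ᶠ x : (Cell 2 × ℤ) × (Cell 2 × ℤ), radCoef r₁ ϱ ‖bondVec a b w x‖ * sqStretch a b w φ x

/-- CONTACT TRANSVERSE SUM `Σ_{0 < ‖e‖ ≤ r₁} (V'(‖e‖)/‖e‖)·‖Δφ‖²` (ordered pairs; the tension table on the FULL difference). [g97] -/
def transSum (r₁ : ℝ) (a b : E3) (w : ℤ → E3) (φ : Cell 2 → ℤ → E3) : ℝ :=
  ∑ᶠ x : (Cell 2 × ℤ) × (Cell 2 × ℤ),
    if 0 < ‖bondVec a b w x‖ ∧ ‖bondVec a b w x‖ ≤ r₁ then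
      ljDeriv ‖bondVec a b w x‖ / ‖bondVec a b w x‖ * ‖φ x.2.1 x.2.2 - φ x.1.1 x.1.2‖ ^ 2 else 0

/-- ★ THE CLUSTER FORM at centre `c` with contact multiplier `μ`: the cluster's share (pair weight / pair mass) of the signed radial table MINUS `μ` on
its contact stretches — a quadratic form in the finitely many values of `φ` on the sites within `R` of `c`. [g97] -/
def clusterForm (r₁ ϱ R μ : ℝ) (a b : E3) (w : ℤ → E3) (c : Cell 2 × ℤ) (φ : Cell 2 → ℤ → E3) : ℝ :=
  ∑ᶠ x : (Cell 2 × ℤ) × (Cell 2 × ℤ),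
    pairWeight R a b w c x / pairMass R a b w x *
      ((radCoef r₁ ϱ ‖bondVec a b w x‖ - if 0 < ‖bondVec a b w x‖ ∧ ‖bondVec a b w x‖ ≤ r₁ then μ else 0) * sqStretch a b w φ x)

/-! ### The four pieces of the split of (SP♯) -/

/-- **(HS♯) «HessianSignSplitP s Λ c₀ ℓ₀ r₁ ϱ τ γT»** — THE SIGN SPLIT OF THE HARMONIC FORM (support · ATTACKABLE-S): on every admissible word, for
every finitely supported `φ` and every value `E` of the ordered-pair harmonic form, `(radialSum + transSum)/2 − τ·N₁ − γT·nnFormZ ≤ E/2`.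
Per ordered pair this is: contact — the IDENTITY `⟨v, forceConst e v⟩ = (V''(ℓ) − V'(ℓ)/ℓ)·⟨e,v⟩²/ℓ² + (V'(ℓ)/ℓ)·‖v‖²`; far window `(r₁, ϱ]` —
`⟨v, forceConst e v⟩ ≥ min(V''(d), 0)·s²` because `V'(d)/d > 0` for `d > 1` (every far pair of a clean word has `d ≥ 6/5`); beyond `ϱ` — the middle
tail in displacement currency along contact paths (`τ`, UY `norm_layeredKernel_le`) and the extreme tail by the PROVED (T) (`γT`).  WEAKER than
(U♯): a termwise inequality with no sign conclusion.  Why it might fail: only by a mis-set `τ` for the chosen `ϱ` (desk: `ϱ = 3.47` needs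
`τ ≈ 0.02`; `ϱ = 49/20` alone would need `τ ≈ 0.3`, too dear — take the stretch window to `3.47`).  Sources: ZZZYJ `bondHess`, B `forceConst_apply`,
NashForceBalance `ljDeriv_pos_of_one_lt`, UY, UW `tailDominationCert_holds`. [g97] -/
def HessianSignSplitP (s Λ c₀ ℓ₀ r₁ ϱ τ γT : ℝ) : Prop :=
  ∀ a : ℝ, 0 < a → ∀ (L : E3 ≃L[ℝ] E3) (w' : ℤ → E3), IsAdmissibleWord a s Λ c₀ ℓ₀ L w' →
    ∀ φ : Cell 2 → ℤ → E3, HasFiniteSupport φ → ∀ E : ℝ,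
      HasSum (fun x : (Cell 2 × ℤ) × (Cell 2 × ℤ) =>
        ⟪φ x.2.1 x.2.2 - φ x.1.1 x.1.2,
          layeredKernel (gen₁ L) (gen₂ L) w' (x.2.1 - x.1.1) x.1.2 x.2.2 (φ x.2.1 x.2.2 - φ x.1.1 x.1.2)⟫) E →
      (radialSum r₁ ϱ (gen₁ L) (gen₂ L) w' φ + transSum r₁ (gen₁ L) (gen₂ L) w' φ) / 2
          - τ * contactForm r₁ (gen₁ L) (gen₂ L) w' φ - γT * nnFormZ φ ≤ E / 2

/-- **(PU♯) «PartitionIdentityP s Λ c₀ ℓ₀ r₁ ϱ R»** — THE CLUSTER PARTITION OF UNITY RESUMS THE RADIAL TABLE (support · ATTACKABLE-S): on every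
admissible word, for every finitely supported `φ` and every `μ`, the cluster forms are summable over the centres with sum `radialSum − μ·S₁`.
Content: `Σ_c pairWeight c x = pairMass x > 0` for every pair of length `≤ ϱ` (needs `R ≥ ϱ/2 + 1`: a site within `1` of the midpoint), finsum
Fubini over (centre, pair) on finite supports (co-Lipschitz word, `φ` finitely supported).  WEAKER: pure bookkeeping.  Why it might fail: `R` too
small for `ϱ` (then a far pair is massless and its deficit is silently dropped — the desk audits coverage).  Sources: JOINT-97 coverage audit. [g97] -/
def PartitionIdentityP (s Λ c₀ ℓ₀ r₁ ϱ R : ℝ) : Prop :=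
  ∀ a : ℝ, 0 < a → ∀ (L : E3 ≃L[ℝ] E3) (w' : ℤ → E3), IsAdmissibleWord a s Λ c₀ ℓ₀ L w' →
    ∀ φ : Cell 2 → ℤ → E3, HasFiniteSupport φ → ∀ μ : ℝ,
      HasSum (fun c : Cell 2 × ℤ => clusterForm r₁ ϱ R μ (gen₁ L) (gen₂ L) w' c φ)
        (radialSum r₁ ϱ (gen₁ L) (gen₂ L) w' φ - μ * stretchForm 0 r₁ (gen₁ L) (gen₂ L) w' φ)

/-- **(TB♯) «TransverseBoundP s Λ c₀ ℓ₀ r₁»** — TENSION FLOOR (support · ATTACKABLE-S · termwise): a common lower bound `β` of `V'(ℓ)/ℓ` over the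
contact bonds of an admissible word gives `β·N₁ ≤ transSum`.  Why it might fail: it cannot (termwise on a finite support).  Sources: definitions. [g97] -/
def TransverseBoundP (s Λ c₀ ℓ₀ r₁ : ℝ) : Prop :=
  ∀ a : ℝ, 0 < a → ∀ (L : E3 ≃L[ℝ] E3) (w' : ℤ → E3), IsAdmissibleWord a s Λ c₀ ℓ₀ L w' →
    ∀ φ : Cell 2 → ℤ → E3, HasFiniteSupport φ → ∀ β : ℝ,
      (∀ x : (Cell 2 × ℤ) × (Cell 2 × ℤ), 0 < ‖bondVec (gen₁ L) (gen₂ L) w' x‖ → ‖bondVec (gen₁ L) (gen₂ L) w' x‖ ≤ r₁ →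
          β ≤ ljDeriv ‖bondVec (gen₁ L) (gen₂ L) w' x‖ / ‖bondVec (gen₁ L) (gen₂ L) w' x‖) →
        β * contactForm r₁ (gen₁ L) (gen₂ L) w' φ ≤ transSum r₁ (gen₁ L) (gen₂ L) w' φ

/-- ★ **(JC♯) «ClusterCertificateP s Λ c₀ ℓ₀ r₁ ϱ R cK τ κ₁»** — THE JOINT CLUSTER CERTIFICATE (crux, rank 3 · SPECIAL · INSTRUMENTED): for every
admissible word there are `μ β : ℝ` with the CLOSURE `2(κ₁ + τ) ≤ μ·cK + β`, `2(κ₁ + τ) ≤ μ + β`, the TENSION FLOOR `β ≤ V'(ℓ)/ℓ` on its contact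
bonds, and AT EVERY CENTRE the finite-dimensional inequality `0 ≤ clusterForm r₁ ϱ R μ c φ` (all `φ`; only the values on the `R`-ball about `c`
enter).  Each bond is paired with its OWN coefficient and each far deficit with the contact stretches of its own cluster, mode by mode (the scalar
format of (SP♯) double worst-cases mixed geometries).  Desk JOINT-97 (`R = √5`, `ϱ = 49/20`, profile `clusterBump`): `κ_w := μ·cK + β ≥ 0.198`
over all 72 nine-letter Hägg environments at `P = Q` across `r₁ ∈ [0.8602, 1.0442]`; `min κ_w = 0.092` over the clean `(P, ρ)` box × {fcc, hcp}
(at `(1.0442, 0.96)`; `0.092–0.128` on the mixed tensile edges, `≥ 0.145` elsewhere); `ϱ ↦ 3.47` costs `≤ 0.135` in `μ`.  WEAKER than (U♯):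
local (one cluster at a time), no summation, no Korn, no currency.  Why it might fail: at the mixed tensile corner `(P, ρ) ≈ (1.044a, 0.96)`
with the `s = 1/50` anisotropy on top, the `R = 2√2`, `ϱ = 3.47` matrices may lose the last `0.09 − 0.04` of margin (the certificate, not the
crystal: `κ_full = 0.29` there) — then enlarge `R` (cluster / Bloch loss `1.05` at `R = √5`) or certify that box globally.  Sources: JOINT-97 /
CASTRAIN-97 desk (memo NODE-g97 §3 (f)–(h)); ARCH-97. [g97] -/
def ClusterCertificateP (s Λ c₀ ℓ₀ r₁ ϱ R cK τ κ₁ : ℝ) : Prop :=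
  ∀ a : ℝ, 0 < a → ∀ (L : E3 ≃L[ℝ] E3) (w' : ℤ → E3), IsAdmissibleWord a s Λ c₀ ℓ₀ L w' →
    ∃ μ β : ℝ, 2 * (κ₁ + τ) ≤ μ * cK + β ∧ 2 * (κ₁ + τ) ≤ μ + β ∧
      (∀ x : (Cell 2 × ℤ) × (Cell 2 × ℤ), 0 < ‖bondVec (gen₁ L) (gen₂ L) w' x‖ → ‖bondVec (gen₁ L) (gen₂ L) w' x‖ ≤ r₁ →
          β ≤ ljDeriv ‖bondVec (gen₁ L) (gen₂ L) w' x‖ / ‖bondVec (gen₁ L) (gen₂ L) w' x‖) ∧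
      ∀ (c : Cell 2 × ℤ) (φ : Cell 2 → ℤ → E3), HasFiniteSupport φ → 0 ≤ clusterForm r₁ ϱ R μ (gen₁ L) (gen₂ L) w' c φ

/-! ### Glue (PROVED) -/

/-- the empty window list makes (SD♯) vacuous. [g97] -/
theorem shellStretchDominationP_zero (s Λ c₀ ℓ₀ r₁ : ℝ) (ρ C : ℕ → ℝ) : ShellStretchDominationP s Λ c₀ ℓ₀ r₁ 0 ρ C := by
  intro a _ L w' _ φ _ i hi
  exact absurd hi (Nat.not_lt_zero i)

/-- THE CERTIFICATE ARITHMETIC (pure real inequalities): sign split + resummed certificate + tension floor + two-sided Korn ⇒ the degenerate budget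
`κ₁·N₁ − γT·Z ≤ E/2`, by a two-case split on the sign of `μ`. [g97] -/
theorem certificate_arith {Rad Tr S₁ N₁ Z E μ β τ γT cK κ₁ : ℝ} (hHS : (Rad + Tr) / 2 - τ * N₁ - γT * Z ≤ E / 2) (hRad : μ * S₁ ≤ Rad)
    (hTr : β * N₁ ≤ Tr) (hK1 : cK * N₁ ≤ S₁) (hK2 : S₁ ≤ N₁) (hN : 0 ≤ N₁) (hc1 : 2 * (κ₁ + τ) ≤ μ * cK + β)
    (hc2 : 2 * (κ₁ + τ) ≤ μ + β) : κ₁ * N₁ - γT * Z ≤ E / 2 := by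
  rcases le_total 0 μ with hμ | hμ
  · have h1 : μ * (cK * N₁) ≤ μ * S₁ := mul_le_mul_of_nonneg_left hK1 hμ
    have h2 : 2 * (κ₁ + τ) * N₁ ≤ (μ * cK + β) * N₁ := mul_le_mul_of_nonneg_right hc1 hN
    nlinarith [h1, h2, hHS, hRad, hTr]
  · have h1 : μ * N₁ ≤ μ * S₁ := mul_le_mul_of_nonpos_left hK2 hμ
    have h2 : 2 * (κ₁ + τ) * N₁ ≤ (μ + β) * N₁ := mul_le_mul_of_nonneg_right hc2 hN
    nlinarith [h1, h2, hHS, hRad, hTr]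

/-- ★★ **GLUE «ClusterCertificate» (PROVED): (K♯) ∧ (HS♯) ∧ (PU♯) ∧ (TB♯) ∧ (JC♯) ⇒ (SP♯) `SignedShellBudgetP s Λ c₀ ℓ₀ r₁ cK κ₁ γT n ρ C`** for EVERY window list `(n,
ρ, C)` — with the degenerate multipliers `γS = 0`, `γN = κ₁`, `γ = 0`: the per-word pair `(μ, β)` of (JC♯) is uniformised through the two-sided Korn inequality
(`certificate_arith`), the resummation (PU♯) turns the centre-wise certificate into `μ·S₁ ≤ radialSum` (`HasSum.nonneg`), (TB♯) gives `β·N₁ ≤ transSum`, (HS♯) compares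
with `E/2`. [g97] -/
theorem signedShellBudgetP_of_clusterCertificate {s Λ c₀ ℓ₀ r₁ ϱ R cK τ κ₁ γT : ℝ} {n : ℕ} {ρ C : ℕ → ℝ}
    (hK : UniformContactKornP s Λ c₀ ℓ₀ r₁ cK) (hHS : HessianSignSplitP s Λ c₀ ℓ₀ r₁ ϱ τ γT) (hPU : PartitionIdentityP s Λ c₀ ℓ₀ r₁ ϱ R)
    (hTB : TransverseBoundP s Λ c₀ ℓ₀ r₁) (hJC : ClusterCertificateP s Λ c₀ ℓ₀ r₁ ϱ R cK τ κ₁) :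
    SignedShellBudgetP s Λ c₀ ℓ₀ r₁ cK κ₁ γT n ρ C := by
  intro a ha
  refine ⟨0, κ₁, fun _ => 0, fun _ => le_rfl, ?_, ?_, ?_⟩
  · simp
  · simp
  intro L w' hadm φ hφ E hE
  obtain ⟨μ, β, hc1, hc2, hβ, hcl⟩ := hJC a ha L w' hadm
  have h1 := hHS a ha L w' hadm φ hφ E hE
  have h2 := hPU a ha L w' hadm φ hφ μ
  have hRad : μ * stretchForm 0 r₁ (gen₁ L) (gen₂ L) w' φ ≤ radialSum r₁ ϱ (gen₁ L) (gen₂ L) w' φ := by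
    have h0 : 0 ≤ radialSum r₁ ϱ (gen₁ L) (gen₂ L) w' φ - μ * stretchForm 0 r₁ (gen₁ L) (gen₂ L) w' φ :=
      HasSum.nonneg (fun c => hcl c φ hφ) h2
    linarith
  have hTr := hTB a ha L w' hadm φ hφ β hβ
  obtain ⟨hK1, hK2⟩ := hK a ha L w' hadm φ hφ
  have hN : 0 ≤ contactForm r₁ (gen₁ L) (gen₂ L) w' φ := contactForm_nonneg _ _ _ _ _
  have hmain := certificate_arith h1 hRad hTr hK1 hK2 hN hc1 hc2
  simpa using hmain

/-- ★★ **THE DOOR OF RECORD AFTER THE SPLIT (PROVED): (RI♯) ∧ (K♯) ∧ (HS♯) ∧ (PU♯) ∧ (TB♯) ∧ (JC♯) ∧ (CZ♯) ⇒ (U♯) `UniformEquilStabilityAt s Λ κ₀ c₀`** for every `κ₀ ≤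
κ₁·cZ − γT`, `0 ≤ κ₁` — the tree door `uniformEquilStabilityAt_of_rigiditySplit` at the empty window list. [g97] -/
theorem uniformEquilStabilityAt_of_clusterCertificate {s Λ c₀ ℓ₀ r₁ ϱ R cK cZ τ κ₁ κ₀ γT : ℝ} (h0 : 0 ≤ κ₁) (hκ : κ₀ ≤ κ₁ * cZ - γT)
    (hRI : UniformReindexP s Λ c₀ ℓ₀) (hK : UniformContactKornP s Λ c₀ ℓ₀ r₁ cK) (hHS : HessianSignSplitP s Λ c₀ ℓ₀ r₁ ϱ τ γT)
    (hPU : PartitionIdentityP s Λ c₀ ℓ₀ r₁ ϱ R) (hTB : TransverseBoundP s Λ c₀ ℓ₀ r₁) (hJC : ClusterCertificateP s Λ c₀ ℓ₀ r₁ ϱ R cK τ κ₁)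
    (hCZ : IndexCurrencyP s Λ c₀ ℓ₀ r₁ cZ) : UniformEquilStabilityAt s Λ κ₀ c₀ :=
  uniformEquilStabilityAt_of_rigiditySplit (n := 0) (ρ := fun _ => 0) (C := fun _ => 0) h0 hκ hRI hK (shellStretchDominationP_zero _ _ _ _ _ _ _)
    (signedShellBudgetP_of_clusterCertificate hK hHS hPU hTB hJC) hCZ

/-- RECORD INSTANCE at the record chart class `(s, Λ) = (1/50, 2)`, `ℓ₀ = 3`, contact cut-off `r₁ = 9/8`, stretch window `ϱ = 7/2`, cluster radius
`R = 3` (`≥ ϱ/2 + 1`), Korn constant `cK = 1/10`, middle-tail price `τ = 1/50`, certificate constant `κ₁ = 1/50` (closure `2(κ₁ + τ) = 2/25 ≤ μ·cK + β`,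
desk `min κ_w = 0.092`), no (T)-tail (`γT = 0`): (U♯) holds with `κ₀ = cZ/50`. [g97] -/
example {c₀ cZ : ℝ} (hRI : UniformReindexP (1 / 50) 2 c₀ 3) (hK : UniformContactKornP (1 / 50) 2 c₀ 3 (9 / 8) (1 / 10))
    (hHS : HessianSignSplitP (1 / 50) 2 c₀ 3 (9 / 8) (7 / 2) (1 / 50) 0) (hPU : PartitionIdentityP (1 / 50) 2 c₀ 3 (9 / 8) (7 / 2) 3)
    (hTB : TransverseBoundP (1 / 50) 2 c₀ 3 (9 / 8)) (hJC : ClusterCertificateP (1 / 50) 2 c₀ 3 (9 / 8) (7 / 2) 3 (1 / 10) (1 / 50) (1 / 50))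
    (hCZ : IndexCurrencyP (1 / 50) 2 c₀ 3 (9 / 8) cZ) : UniformEquilStabilityAt (1 / 50) 2 (cZ / 50) c₀ :=
  uniformEquilStabilityAt_of_clusterCertificate (κ₁ := 1 / 50) (γT := 0) (by norm_num) (by ring_nf; rfl) hRI hK hHS hPU hTB hJC hCZ

end

end Summit.AtomisticToContinuum.Crystallization.Theorems.ChartedZeroExcessLayeredLatticeLiouville
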